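import Literature.Analysis.Complex.RieszMeanDescent
import Literature.Analysis.Complex.PerronDirichletSeries
import Literature.Analysis.Complex.CahenMellinDirichlet
import Mathlib.NumberTheory.LSeries.Basic
import HarnessLib

/-!
# A power saving for the coefficients of a non-negative Dirichlet series with one simple pole
(Perron's formula of order `6`, a contour shift, and the Riesz-mean descent)

Topic `Analysis/Complex`, namespace `Literature.Analysis.Complex`. Proof file (theorems only; no
definition, no named fact). Let `D(w) = Σ Cₙ n^{-w}` with `Cₙ ≥ 0` and `Σ Cₙ n^{-5/2} < ∞`, and
suppose `D` has a continuation `𝒟` which is holomorphic on `{Re w > 3/2} ∖ {2}`, of the form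
`𝒟(w) = φ(w)/(w - 2)` with `φ` holomorphic on `{Re w > 3/2}` (a simple pole at `w = 2` with
residue `φ(2)`, `Re φ(2) ≥ 0`), and of polynomial growth `‖𝒟(w)‖ ≤ K (1 + |Im w|)⁵` on
`3/2 + ε ≤ Re w ≤ 5/2`, `|Im w| ≥ 1` (`0 < ε < 1/2`). We PROVE (Montgomery–Vaughan, *Multiplicative
Number Theory I*, §5.1–5.2; the shape of every "Perron with one pole" argument):

* `integral_LSeries_mul_perronPow` — **Perron's formula of order `m ≥ 1` on a line `Re w = c ≥ 1`
  of absolute convergence**: `∫ D(c+it) x^{c+it} (c+it)^{-(m+1)} dt = 2π Σ_{n ≤ x} Cₙ (log x/n)ᵐ/m!`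
  (the tree's `integral_perronPow_vertical`, sum and integral interchanged by absolute convergence);
* `riesz_six_asymp` — **the contour shift**: `|Σ_{n ≤ x} Cₙ (log x/n)⁶/6! - Re φ(2) x²/2⁷| ≤
  (L/2π) x^{3/2+ε}` for `x ≥ 1` (the residue theorem for the strip `3/2 + ε ≤ Re w ≤ 5/2` of the
  tree, `integral_vertical_sub_eq_sum_of_simplePoles`, with the kernel `x^w/w⁷`);
* `coeff_powerSaving_of_continuation` — **`Cₙ ≤ K' n^{2 - (1/2 - ε)/64}`** for all `n ≥ 1`
  (six descent steps, `riesz_descent_iter`, and `coeff_le_of_partialSum` of `RieszMeanDescent`).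

This is the Tauberian end of the unconditional Rankin–Selberg power saving for cusp-form
coefficients (`Literature.NumberTheory.Automorphic.RankinSelberg*`).

## References

* H. L. Montgomery, R. C. Vaughan, *Multiplicative Number Theory I*, CUP 2007, §5.1–§5.2.
* R. A. Rankin, Proc. Cambridge Philos. Soc. 35 (1939), 357–372, §4 (the original application).
-/

noncomputable section

open Complex Set Filter Topology MeasureTheory Real Finset
open scoped Interval

namespace Literature.Analysis.Complex

/-! ### Perron's formula of order `m` on a line of absolute convergence -/

section Perron

variable {C : ℕ → ℝ}

/-- The `L¹` norm of the kernel on `Re w = c ≥ 1`: `∫ ‖x^{c+it}(c+it)^{-(m+1)}‖ dt ≤ π x^c`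
(`m ≥ 1`; `‖c + it‖^{m+1} ≥ c² + t² ≥ 1 + t²`). [folklore] -/
theorem integral_norm_perronPow_le {x : ℝ} (hx : 0 < x) {m : ℕ} (hm : 1 ≤ m) {c : ℝ} (hc : 1 ≤ c) :
    ∫ t : ℝ, ‖perronPow x m ((c : ℂ) + t * I)‖ ≤ Real.pi * x ^ c := by
  have hc0 : c ≠ 0 := by linarith
  have hint := (integrable_perronPow_vertical hx hm hc0).norm
  have hbound : ∀ t : ℝ, ‖perronPow x m ((c : ℂ) + t * I)‖ ≤ x ^ c * (1 + t ^ 2)⁻¹ := by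
    intro t
    rw [norm_perronPow hx]
    have hsq : ‖(c : ℂ) + t * I‖ ^ 2 = c ^ 2 + t ^ 2 := by
      rw [Complex.sq_norm, Complex.normSq_apply]; simp; ring
    have hn1 : 1 ≤ ‖(c : ℂ) + t * I‖ := by
      have := abs_re_le_norm_line c t
      rw [abs_of_pos (by linarith)] at this
      linarith
    have hpow : 1 + t ^ 2 ≤ ‖(c : ℂ) + t * I‖ ^ (m + 1) := by
      calc 1 + t ^ 2 ≤ c ^ 2 + t ^ 2 := by nlinarith
        _ = ‖(c : ℂ) + t * I‖ ^ 2 := hsq.symm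
        _ ≤ ‖(c : ℂ) + t * I‖ ^ (m + 1) := pow_le_pow_right₀ hn1 (by omega)
    rw [div_eq_mul_inv]
    exact mul_le_mul_of_nonneg_left (inv_anti₀ (by positivity) hpow) (by positivity)
  calc ∫ t : ℝ, ‖perronPow x m ((c : ℂ) + t * I)‖ ≤ ∫ t : ℝ, x ^ c * (1 + t ^ 2)⁻¹ :=
        integral_mono hint (integrable_inv_one_add_sq.const_mul _) hbound
    _ = Real.pi * x ^ c := by rw [MeasureTheory.integral_const_mul, integral_univ_inv_one_add_sq]; ring

/-- **Perron's formula of order `m ≥ 1` for `D(w) = Σ Cₙ n^{-w}` on a line `Re w = c ≥ 1` of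
absolute convergence** (Montgomery–Vaughan (5.22), Riesz typical means): for `x > 0`,
`∫ D(c+it) x^{c+it}(c+it)^{-(m+1)} dt = 2π Σ_{1 ≤ n ≤ x} Cₙ (log x/n)ᵐ/m!`.
[cite: MontgomeryVaughan2007, Section 5.1 eq. 5.22] -/
theorem integral_LSeries_mul_perronPow {c : ℝ} (hc : 1 ≤ c)
    (hCs : Summable fun n : ℕ ↦ ‖(C n : ℂ)‖ / (n : ℝ) ^ c) {x : ℝ} (hx : 0 < x) {m : ℕ} (hm : 1 ≤ m) :
    ∫ t : ℝ, LSeries (fun n ↦ (C n : ℂ)) ((c : ℂ) + t * I) * perronPow x m ((c : ℂ) + t * I) =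
      2 * Real.pi * ∑ n ∈ Finset.Icc 1 ⌊x⌋₊,
        (C n : ℂ) * (((Real.log (x / n) : ℝ) : ℂ) ^ m / (m.factorial : ℂ)) := by
  have hc0 : (0 : ℝ) < c := by linarith
  set term : ℕ → ℝ → ℂ := fun n t ↦ (C n : ℂ) * perronPow (x / n) m ((c : ℂ) + t * I) with hterm
  have hct : ∀ t : ℝ, ((c : ℂ) + t * I) ≠ 0 := fun t h ↦ by
    have := congrArg Complex.re h; simp at this; linarith
  have h00 : ∀ t : ℝ, perronPow 0 m ((c : ℂ) + t * I) = 0 := fun t ↦ by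
    rw [perronPow, Complex.ofReal_zero, Complex.zero_cpow (hct t), zero_div]
  -- (a) pointwise expansion of the integrand
  have hpt : ∀ t : ℝ, LSeries (fun n ↦ (C n : ℂ)) ((c : ℂ) + t * I) * perronPow x m ((c : ℂ) + t * I) =
      ∑' n : ℕ, term n t := by
    intro t
    rw [LSeries, ← tsum_mul_right]
    refine tsum_congr fun n ↦ ?_
    rcases Nat.eq_zero_or_pos n with rfl | hn
    · simp [hterm, LSeries.term_zero, h00]
    · rw [LSeries.term_of_ne_zero hn.ne', hterm]
      simp only
      unfold perronPow
      rw [ofReal_div_natCast_cpow hx.le hn]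
      have hns : (n : ℂ) ^ ((c : ℂ) + t * I) ≠ 0 :=
        Complex.cpow_ne_zero_iff.2 (Or.inl (by exact_mod_cast hn.ne'))
      field_simp
  -- (b) integrability of each term
  have hint : ∀ n : ℕ, Integrable (term n) := by
    intro n
    rcases Nat.eq_zero_or_pos n with rfl | hn
    · have : term 0 = fun _ ↦ 0 := by
        funext t; simp [hterm, h00]
      rw [this]; exact integrable_zero _ _ _
    · have hxn : 0 < x / n := div_pos hx (by exact_mod_cast hn)
      exact (integrable_perronPow_vertical hxn hm hc0.ne').const_mul _
  -- (c) summability of the `L¹` norms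
  have hsum : Summable fun n : ℕ ↦ ∫ t : ℝ, ‖term n t‖ := by
    refine Summable.of_nonneg_of_le (fun n ↦ integral_nonneg fun t ↦ norm_nonneg _)
      (fun n ↦ ?_) (hCs.mul_left (Real.pi * x ^ c))
    rcases Nat.eq_zero_or_pos n with rfl | hn
    · simp [hterm, h00, Real.zero_rpow hc0.ne']
    · have hn0 : (0 : ℝ) < n := by exact_mod_cast hn
      have hxn : 0 < x / n := div_pos hx hn0
      calc ∫ t : ℝ, ‖term n t‖
          = ‖(C n : ℂ)‖ * ∫ t : ℝ, ‖perronPow (x / n) m ((c : ℂ) + t * I)‖ := by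
            simp only [hterm, norm_mul]
            rw [MeasureTheory.integral_const_mul]
        _ ≤ ‖(C n : ℂ)‖ * (Real.pi * (x / n) ^ c) :=
            mul_le_mul_of_nonneg_left (integral_norm_perronPow_le hxn hm hc) (norm_nonneg _)
        _ = Real.pi * x ^ c * (‖(C n : ℂ)‖ / (n : ℝ) ^ c) := by
            rw [Real.div_rpow hx.le hn0.le]
            have : (n : ℝ) ^ c ≠ 0 := (Real.rpow_pos_of_pos hn0 c).ne'
            field_simp
  -- (d) interchange and evaluate termwise
  rw [show (fun t : ℝ ↦ LSeries (fun n ↦ (C n : ℂ)) ((c : ℂ) + t * I) * perronPow x m ((c : ℂ) + t * I)) =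
      fun t ↦ ∑' n : ℕ, term n t from funext hpt, ← integral_tsum_of_summable_integral_norm hint hsum]
  have hV : ∀ n : ℕ, ∫ t : ℝ, term n t = (C n : ℂ) * ∫ t : ℝ, perronPow (x / n) m ((c : ℂ) + t * I) :=
    fun n ↦ MeasureTheory.integral_const_mul _ _
  simp_rw [hV]
  -- only `1 ≤ n ≤ ⌊x⌋` contribute
  have hval : ∀ n : ℕ, 1 ≤ n → ∫ t : ℝ, perronPow (x / n) m ((c : ℂ) + t * I) =
      if 1 ≤ x / n then 2 * Real.pi * ((((Real.log (x / n) : ℝ) : ℂ) ^ m) / (m.factorial : ℂ)) else 0 := by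
    intro n hn
    have hxn : 0 < x / n := div_pos hx (by exact_mod_cast hn)
    rw [integral_perronPow_vertical hxn hc0 hm]
  have hsupp : ∀ n : ℕ, n ∉ Finset.Icc 1 ⌊x⌋₊ →
      (C n : ℂ) * ∫ t : ℝ, perronPow (x / n) m ((c : ℂ) + t * I) = 0 := by
    intro n hn
    rw [Finset.mem_Icc, not_and_or, not_le, not_le] at hn
    rcases hn with hn | hn
    · have : n = 0 := by omega
      subst this
      refine Or.inr ?_ |> fun h ↦ mul_eq_zero.mpr h
      simp [h00]
    · have hn1 : 1 ≤ n := by omega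
      rw [hval n hn1]
      have hlt : x / n < 1 := by
        rw [div_lt_one (by exact_mod_cast (show 0 < n by omega))]
        exact (Nat.floor_lt hx.le).1 hn
      rw [if_neg (not_le.2 hlt), mul_zero]
  rw [tsum_eq_sum (s := Finset.Icc 1 ⌊x⌋₊) (fun n hn ↦ hsupp n hn), Finset.mul_sum]
  refine Finset.sum_congr rfl fun n hn ↦ ?_
  obtain ⟨hn1, hnx⟩ := Finset.mem_Icc.1 hn
  have hn0 : (0 : ℝ) < n := by exact_mod_cast hn1
  have hxn1 : 1 ≤ x / n := by
    rw [le_div_iff₀ hn0, one_mul]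
    exact le_trans (by exact_mod_cast hnx) (Nat.floor_le hx.le)
  rw [hval n hn1, if_pos hxn1]
  ring

end Perron

/-! ### The contour shift past the simple pole at `w = 2` -/

section Shift

variable {C : ℕ → ℝ}

/-- `x^w/w⁷ = x^w · (1/w⁷)`: `perronPow x m w = x^w · perronPow 1 m w`. [folklore] -/
theorem perronPow_eq_cpow_mul (x : ℝ) (m : ℕ) (w : ℂ) :
    perronPow x m w = (x : ℂ) ^ w * perronPow 1 m w := by
  unfold perronPow
  rw [Complex.ofReal_one, Complex.one_cpow]
  ring

/-- **Integrability of `𝒟 · w^{-7}` on the line `Re w = 3/2 + ε`** from the polynomial bound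
`‖𝒟‖ ≤ K(1+|Im w|)⁵` for `|Im w| ≥ 1` and continuity on `|Im w| ≤ 1` (majorant `M/(1+y²)`).
[folklore] -/
theorem integrable_continuation_line {Dt : ℂ → ℂ} (hDiff : DifferentiableOn ℂ Dt {w | 3 / 2 < w.re ∧ w ≠ 2})
    {ε K : ℝ} (hε : 0 < ε) (hε2 : ε < 1 / 2) (hK : 0 ≤ K)
    (hbd : ∀ w : ℂ, 3 / 2 + ε ≤ w.re → w.re ≤ 5 / 2 → 1 ≤ |w.im| → ‖Dt w‖ ≤ K * (1 + |w.im|) ^ 5) :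
    Integrable fun y : ℝ ↦ Dt (((3 / 2 + ε : ℝ) : ℂ) + y * I) * perronPow 1 6 (((3 / 2 + ε : ℝ) : ℂ) + y * I) := by
  set a : ℝ := 3 / 2 + ε with ha
  have ha0 : a ≠ 0 := by rw [ha]; linarith
  have ha1 : 1 < a := by rw [ha]; linarith
  -- continuity on the line
  have hline : ∀ y : ℝ, ((a : ℂ) + y * I) ∈ {w : ℂ | 3 / 2 < w.re ∧ w ≠ 2} := by
    intro y
    refine ⟨by simp [ha]; linarith, fun h ↦ ?_⟩
    have := congrArg Complex.re h; simp [ha] at this; linarith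
  have hDc : Continuous fun y : ℝ ↦ Dt ((a : ℂ) + y * I) :=
    hDiff.continuousOn.comp_continuous (by fun_prop) hline
  have hPc : Continuous fun y : ℝ ↦ perronPow 1 6 ((a : ℂ) + y * I) :=
    continuous_perronPow_vertical one_pos 6 ha0
  have hmeas : AEStronglyMeasurable (fun y : ℝ ↦ Dt ((a : ℂ) + y * I) * perronPow 1 6 ((a : ℂ) + y * I)) volume :=
    (hDc.mul hPc).aestronglyMeasurable
  -- bound on `|y| ≤ 1` by compactness
  obtain ⟨M₀, hM₀⟩ := (isCompact_Icc (a := (-1 : ℝ)) (b := 1)).exists_bound_of_continuousOn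
    hDc.continuousOn
  have hM₀0 : 0 ≤ max M₀ 0 := le_max_right _ _
  set M : ℝ := 2 * max M₀ 0 + 128 * K with hM
  refine Integrable.mono' ((integrable_inv_one_add_sq).const_mul M) hmeas (ae_of_all _ fun y ↦ ?_)
  rw [norm_mul, norm_perronPow one_pos, Real.one_rpow]
  have hny : |y| ≤ ‖(a : ℂ) + y * I‖ := abs_im_le_norm_line a y
  have hna : 1 ≤ ‖(a : ℂ) + y * I‖ := by
    have := abs_re_le_norm_line a y; rw [abs_of_pos (by linarith)] at this; linarith
  have hy2 : 0 < 1 + y ^ 2 := by positivity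
  rcases le_or_gt |y| 1 with hy | hy
  · -- `|y| ≤ 1`
    have h1 : ‖Dt ((a : ℂ) + y * I)‖ ≤ max M₀ 0 := (hM₀ y (abs_le.mp hy)).trans (le_max_left _ _)
    have h2 : 1 / ‖(a : ℂ) + y * I‖ ^ (6 + 1) ≤ 1 := by
      rw [div_le_one (by positivity)]; exact one_le_pow₀ hna
    have h3 : (1 : ℝ) ≤ 2 * (1 + y ^ 2)⁻¹ := by
      rw [← div_eq_mul_inv, le_div_iff₀ hy2]
      have : y ^ 2 ≤ 1 := by
        have := abs_le.mp hy; nlinarith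
      linarith
    calc ‖Dt ((a : ℂ) + y * I)‖ * (1 / ‖(a : ℂ) + y * I‖ ^ (6 + 1)) ≤ max M₀ 0 * 1 :=
          mul_le_mul h1 h2 (by positivity) hM₀0
      _ ≤ max M₀ 0 * (2 * (1 + y ^ 2)⁻¹) := mul_le_mul_of_nonneg_left h3 hM₀0
      _ ≤ M * (1 + y ^ 2)⁻¹ := by
          rw [hM]
          have : 0 ≤ 128 * K * (1 + y ^ 2)⁻¹ := by positivity
          nlinarith
  · -- `|y| ≥ 1`
    have h1 : ‖Dt ((a : ℂ) + y * I)‖ ≤ K * (1 + |y|) ^ 5 := by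
      have := hbd ((a : ℂ) + y * I) (by simp [ha]) (by simp [ha]; linarith) (by simpa using hy.le)
      simpa using this
    have hy0 : 0 < |y| := by linarith
    have h2 : 1 / ‖(a : ℂ) + y * I‖ ^ (6 + 1) ≤ 1 / |y| ^ 7 :=
      div_le_div_of_nonneg_left zero_le_one (by positivity) (by simpa using pow_le_pow_left₀ hy0.le hny 7)
    have h3 : (1 + |y|) ^ 7 ≤ 128 * |y| ^ 7 := by
      have : 1 + |y| ≤ 2 * |y| := by linarith
      calc (1 + |y|) ^ 7 ≤ (2 * |y|) ^ 7 := pow_le_pow_left₀ (by positivity) this 7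
        _ = 128 * |y| ^ 7 := by ring
    have h4 : 1 + y ^ 2 ≤ (1 + |y|) ^ 2 := by rw [← sq_abs y]; nlinarith [abs_nonneg y]
    have h1y : 0 < 1 + |y| := by positivity
    calc ‖Dt ((a : ℂ) + y * I)‖ * (1 / ‖(a : ℂ) + y * I‖ ^ (6 + 1))
        ≤ (K * (1 + |y|) ^ 5) * (1 / |y| ^ 7) := mul_le_mul h1 h2 (by positivity) (by positivity)
      _ ≤ (K * (1 + |y|) ^ 5) * (128 / (1 + |y|) ^ 7) := by
          refine mul_le_mul_of_nonneg_left ?_ (by positivity)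
          rw [div_le_div_iff₀ (by positivity) (by positivity)]; linarith
      _ = 128 * K / (1 + |y|) ^ 2 := by field_simp
      _ ≤ 128 * K / (1 + y ^ 2) := div_le_div_of_nonneg_left (by positivity) hy2 h4
      _ ≤ M * (1 + y ^ 2)⁻¹ := by
          rw [div_eq_mul_inv, hM]
          have : 0 ≤ 2 * max M₀ 0 * (1 + y ^ 2)⁻¹ := by positivity
          nlinarith [inv_pos.mpr hy2]

/-- **The contour shift** (Perron with one simple pole): with `𝒟 = D` on `Re w > 2`, `𝒟 = φ/(w-2)`,
polynomial growth in `3/2 + ε ≤ Re w ≤ 5/2`, the Riesz mean of order `6` satisfies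
`|Σ_{n ≤ x} Cₙ (log x/n)⁶/6! - Re φ(2) x²/2⁷| ≤ L x^{3/2 + ε}` for `x ≥ 1`
(Montgomery–Vaughan §5.2; the residue theorem between `Re w = 3/2 + ε` and `Re w = 5/2`).
[cite: MontgomeryVaughan2007, Section 5.2] -/
theorem riesz_six_asymp (hC : ∀ n, 0 ≤ C n) (hCs : Summable fun n : ℕ ↦ C n / (n : ℝ) ^ (5 / 2 : ℝ))
    {Dt φ : ℂ → ℂ} (hDiff : DifferentiableOn ℂ Dt {w | 3 / 2 < w.re ∧ w ≠ 2})
    (hEq : ∀ w : ℂ, 2 < w.re → Dt w = LSeries (fun n ↦ (C n : ℂ)) w)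
    (hφd : ∀ w : ℂ, 3 / 2 < w.re → DifferentiableAt ℂ φ w) (hφeq : ∀ w : ℂ, Dt w = φ w / (w - 2))
    {ε K : ℝ} (hε : 0 < ε) (hε2 : ε < 1 / 2) (hK : 0 ≤ K)
    (hbd : ∀ w : ℂ, 3 / 2 + ε ≤ w.re → w.re ≤ 5 / 2 → 1 ≤ |w.im| → ‖Dt w‖ ≤ K * (1 + |w.im|) ^ 5) :
    ∃ L : ℝ, 0 ≤ L ∧ ∀ x : ℝ, 1 ≤ x →
      |(∑ n ∈ Finset.Icc 1 ⌊x⌋₊, C n * (Real.log (x / n)) ^ 6 / (6 : ℕ).factorial) -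
          (φ 2).re / 2 ^ 7 * x ^ 2| ≤ L * x ^ (3 / 2 + ε) := by
  set a : ℝ := 3 / 2 + ε with ha
  have ha0 : a ≠ 0 := by rw [ha]; linarith
  have ha1 : 1 < a := by rw [ha]; linarith
  have hgl := integrable_continuation_line hDiff hε hε2 hK hbd
  set L₀ : ℝ := ∫ y : ℝ, ‖Dt ((a : ℂ) + y * I) * perronPow 1 6 ((a : ℂ) + y * I)‖ with hL₀
  have hL₀0 : 0 ≤ L₀ := integral_nonneg fun y ↦ norm_nonneg _
  refine ⟨L₀ / (2 * Real.pi), by positivity, fun x hx ↦ ?_⟩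
  have hx0 : 0 < x := by linarith
  set F : ℂ → ℂ := fun w ↦ Dt w * perronPow x 6 w with hF
  -- summability of the Dirichlet series on `Re w = 5/2`
  have hCs' : Summable fun n : ℕ ↦ ‖(C n : ℂ)‖ / (n : ℝ) ^ (5 / 2 : ℝ) :=
    hCs.congr fun n ↦ by rw [Complex.norm_real, Real.norm_of_nonneg (hC n)]
  set D₀ : ℝ := ∑' n : ℕ, C n / (n : ℝ) ^ (5 / 2 : ℝ) with hD₀
  have hLnorm : ∀ y : ℝ, ‖LSeries (fun n ↦ (C n : ℂ)) (((5 / 2 : ℝ) : ℂ) + y * I)‖ ≤ D₀ := by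
    intro y
    have hre : ((((5 / 2 : ℝ) : ℂ)) + y * I).re = 5 / 2 := by simp
    have hterm : ∀ n : ℕ, ‖LSeries.term (fun n ↦ (C n : ℂ)) (((5 / 2 : ℝ) : ℂ) + y * I) n‖ =
        C n / (n : ℝ) ^ (5 / 2 : ℝ) := by
      intro n
      rcases Nat.eq_zero_or_pos n with rfl | hn
      · simp [LSeries.term_zero, Real.zero_rpow (by norm_num : (5 / 2 : ℝ) ≠ 0)]
      · rw [LSeries.norm_term_eq, if_neg hn.ne', hre, Complex.norm_real, Real.norm_of_nonneg (hC n)]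
    have hsn : Summable fun n ↦ ‖LSeries.term (fun n ↦ (C n : ℂ)) (((5 / 2 : ℝ) : ℂ) + y * I) n‖ := by
      simp_rw [hterm]; exact hCs
    calc ‖LSeries (fun n ↦ (C n : ℂ)) (((5 / 2 : ℝ) : ℂ) + y * I)‖
        ≤ ∑' n, ‖LSeries.term (fun n ↦ (C n : ℂ)) (((5 / 2 : ℝ) : ℂ) + y * I) n‖ := norm_tsum_le_tsum_norm hsn
      _ = D₀ := by simp_rw [hterm]; rfl
  -- (1) Perron on `Re w = 5/2`
  have hPerron := integral_LSeries_mul_perronPow (C := C) (c := 5 / 2) (by norm_num) hCs' hx0 (m := 6) (by norm_num)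
  have hEqline : ∀ y : ℝ, F (((5 / 2 : ℝ) : ℂ) + y * I) =
      LSeries (fun n ↦ (C n : ℂ)) (((5 / 2 : ℝ) : ℂ) + y * I) * perronPow x 6 (((5 / 2 : ℝ) : ℂ) + y * I) := by
    intro y; rw [hF]; simp only; rw [hEq _ (by simp; norm_num)]
  have hIb : ∫ y : ℝ, F (((5 / 2 : ℝ) : ℂ) + y * I) =
      2 * Real.pi * ∑ n ∈ Finset.Icc 1 ⌊x⌋₊, (C n : ℂ) * ((((Real.log (x / n) : ℝ) : ℂ) ^ 6) / ((6 : ℕ).factorial : ℂ)) := by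
    rw [show (fun y : ℝ ↦ F (((5 / 2 : ℝ) : ℂ) + y * I)) = fun y : ℝ ↦
      LSeries (fun n ↦ (C n : ℂ)) (((5 / 2 : ℝ) : ℂ) + y * I) * perronPow x 6 (((5 / 2 : ℝ) : ℂ) + y * I)
      from funext hEqline]
    exact hPerron
  -- (2) the residue theorem between `Re w = a` and `Re w = 5/2`
  set U : Set ℂ := {w : ℂ | 3 / 2 < w.re} with hU
  have hUo : IsOpen U := isOpen_lt continuous_const Complex.continuous_re
  have hab : a < 5 / 2 := by rw [ha]; linarith
  have hKU : Complex.re ⁻¹' Icc a (5 / 2) ⊆ U := fun w hw ↦ by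
    simp only [Set.mem_preimage, Set.mem_Icc] at hw; show 3 / 2 < w.re; rw [ha] at hw; linarith [hw.1]
  have hUS : U \ ({(2 : ℂ)} : Finset ℂ) = {w : ℂ | 3 / 2 < w.re ∧ w ≠ 2} := by
    ext w; simp [hU]
  have hw0 : ∀ w ∈ U, w ≠ 0 := fun w hw h ↦ by
    have : 3 / 2 < w.re := hw; rw [h] at this; simp at this; linarith
  have hFd : DifferentiableOn ℂ F (U \ ({(2 : ℂ)} : Finset ℂ)) := by
    rw [hUS]
    intro w hw
    have hwU : w ∈ U := hw.1
    exact (hDiff w hw).mul (differentiableAt_perronPow hx0 6 (hw0 w hwU)).differentiableWithinAt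
  have hpole : ∀ p ∈ ({(2 : ℂ)} : Finset ℂ), ∃ φ' : ℂ → ℂ, ∃ V ∈ 𝓝 p, DifferentiableOn ℂ φ' V ∧
      φ' p = (fun p ↦ φ p * perronPow x 6 p) p ∧ ∀ z ∈ V, z ≠ p → F z = φ' z / (z - p) := by
    intro p hp
    rw [Finset.mem_singleton] at hp
    subst hp
    refine ⟨fun w ↦ φ w * perronPow x 6 w, U, hUo.mem_nhds (by show (3 : ℝ) / 2 < (2 : ℂ).re; simp; norm_num),
      fun w hw ↦ ((hφd w hw).mul (differentiableAt_perronPow hx0 6 (hw0 w hw))).differentiableWithinAt,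
      rfl, fun z _ _ ↦ ?_⟩
    rw [hF]; simp only; rw [hφeq z]; ring
  -- integrability on the two lines
  have hxcont : ∀ σ : ℝ, Continuous fun y : ℝ ↦ (x : ℂ) ^ ((σ : ℂ) + y * I) := fun σ ↦
    Continuous.const_cpow (by fun_prop) (Or.inl (by exact_mod_cast hx0.ne'))
  have hxnorm : ∀ σ y : ℝ, ‖(x : ℂ) ^ ((σ : ℂ) + y * I)‖ = x ^ σ := fun σ y ↦ by
    rw [Complex.norm_cpow_eq_rpow_re_of_pos hx0]; simp
  have hIa : Integrable fun y : ℝ ↦ F ((a : ℂ) + y * I) := by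
    have e : (fun y : ℝ ↦ F ((a : ℂ) + y * I)) = fun y : ℝ ↦ (x : ℂ) ^ ((a : ℂ) + y * I) *
        (Dt ((a : ℂ) + y * I) * perronPow 1 6 ((a : ℂ) + y * I)) := by
      funext y; rw [hF]; simp only; rw [perronPow_eq_cpow_mul x]; ring
    rw [e]
    exact hgl.bdd_mul (hxcont a).aestronglyMeasurable (ae_of_all _ fun y ↦ (hxnorm a y).le)
  have hIbint : Integrable fun y : ℝ ↦ F (((5 / 2 : ℝ) : ℂ) + y * I) := by
    have h52 : (5 / 2 : ℝ) ≠ 0 := by norm_num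
    have hline : ∀ y : ℝ, ((((5 / 2 : ℝ) : ℂ)) + y * I) ∈ {w : ℂ | 3 / 2 < w.re ∧ w ≠ 2} := by
      intro y; refine ⟨by simp; norm_num, fun h ↦ ?_⟩
      have := congrArg Complex.re h; simp at this; norm_num at this
    have hDc : Continuous fun y : ℝ ↦ Dt ((((5 / 2 : ℝ) : ℂ)) + y * I) :=
      hDiff.continuousOn.comp_continuous (by fun_prop) hline
    have hP1 : Integrable fun y : ℝ ↦ perronPow 1 6 ((((5 / 2 : ℝ) : ℂ)) + y * I) :=
      integrable_perronPow_vertical one_pos (by norm_num) h52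
    have hDP : Integrable fun y : ℝ ↦ Dt ((((5 / 2 : ℝ) : ℂ)) + y * I) * perronPow 1 6 ((((5 / 2 : ℝ) : ℂ)) + y * I) :=
      hP1.bdd_mul hDc.aestronglyMeasurable (ae_of_all _ fun y ↦ by
        show ‖Dt ((((5 / 2 : ℝ) : ℂ)) + y * I)‖ ≤ D₀
        rw [hEq _ (by simp; norm_num)]; exact hLnorm y)
    have e : (fun y : ℝ ↦ F ((((5 / 2 : ℝ) : ℂ)) + y * I)) = fun y : ℝ ↦ (x : ℂ) ^ ((((5 / 2 : ℝ) : ℂ)) + y * I) *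
        (Dt ((((5 / 2 : ℝ) : ℂ)) + y * I) * perronPow 1 6 ((((5 / 2 : ℝ) : ℂ)) + y * I)) := by
      funext y; rw [hF]; simp only; rw [perronPow_eq_cpow_mul x]; ring
    rw [e]
    exact hDP.bdd_mul (hxcont (5 / 2)).aestronglyMeasurable (ae_of_all _ fun y ↦ (hxnorm _ y).le)
  -- decay on horizontal segments
  have hdecay : ∀ η : ℝ, 0 < η → ∃ T₀ : ℝ, ∀ T : ℝ, T₀ ≤ |T| → ∀ σ ∈ Icc a (5 / 2), ‖F (σ + T * I)‖ ≤ η := by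
    intro η hη
    refine ⟨max 1 (32 * K * x ^ (5 / 2 : ℝ) / η), fun T hT σ hσ ↦ ?_⟩
    have hT1 : 1 ≤ |T| := (le_max_left _ _).trans hT
    have hT2 : 32 * K * x ^ (5 / 2 : ℝ) / η ≤ |T| := (le_max_right _ _).trans hT
    have hT0 : 0 < |T| := by linarith
    obtain ⟨hσ1, hσ2⟩ := hσ
    rw [hF]; simp only
    rw [norm_mul, norm_perronPow hx0]
    have h1 : ‖Dt ((σ : ℂ) + T * I)‖ ≤ K * (1 + |T|) ^ 5 := by
      have := hbd ((σ : ℂ) + T * I) (by simp; rw [ha] at hσ1; exact hσ1) (by simp; exact hσ2) (by simpa using hT1)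
      simpa using this
    have h2 : x ^ σ ≤ x ^ (5 / 2 : ℝ) := Real.rpow_le_rpow_of_exponent_le hx hσ2
    have h3 : |T| ^ 7 ≤ ‖(σ : ℂ) + T * I‖ ^ (6 + 1) := by
      simpa using pow_le_pow_left₀ (abs_nonneg T) (abs_im_le_norm_line σ T) 7
    have h4 : (1 + |T|) ^ 5 ≤ 32 * |T| ^ 5 := by
      calc (1 + |T|) ^ 5 ≤ (2 * |T|) ^ 5 := pow_le_pow_left₀ (by positivity) (by linarith) 5
        _ = 32 * |T| ^ 5 := by ring
    calc ‖Dt ((σ : ℂ) + T * I)‖ * (x ^ σ / ‖(σ : ℂ) + T * I‖ ^ (6 + 1))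
        ≤ (K * (1 + |T|) ^ 5) * (x ^ (5 / 2 : ℝ) / |T| ^ 7) := by
          refine mul_le_mul h1 ?_ (by positivity) (by positivity)
          exact div_le_div₀ (by positivity) h2 (by positivity) h3
      _ ≤ (K * (32 * |T| ^ 5)) * (x ^ (5 / 2 : ℝ) / |T| ^ 7) := by gcongr
      _ = 32 * K * x ^ (5 / 2 : ℝ) / |T| / |T| := by field_simp
      _ ≤ η := by
          rw [div_le_iff₀ hT0]
          have h5 : 32 * K * x ^ (5 / 2 : ℝ) / |T| ≤ η := by
            rw [div_le_iff₀ hT0]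
            rw [div_le_iff₀ hη] at hT2
            linarith [mul_comm η |T|]
          calc 32 * K * x ^ (5 / 2 : ℝ) / |T| ≤ η := h5
            _ = η * 1 := (mul_one η).symm
            _ ≤ η * |T| := mul_le_mul_of_nonneg_left hT1 hη.le
  have hres := integral_vertical_sub_eq_sum_of_simplePoles (F := F) hab ({(2 : ℂ)} : Finset ℂ)
    (fun p ↦ φ p * perronPow x 6 p) U hUo hKU
    (fun p hp ↦ by rw [Finset.mem_singleton] at hp; subst hp; simp; rw [ha]; constructor <;> linarith)
    hFd hpole hIa hIbint hdecay
  rw [Finset.sum_singleton, hIb] at hres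
  -- (3) the error term
  set E : ℂ := ∫ y : ℝ, F ((a : ℂ) + y * I) with hE
  have hP2 : perronPow x 6 2 = (((x ^ 2 / 2 ^ 7 : ℝ)) : ℂ) := by
    unfold perronPow
    rw [show (2 : ℂ) = ((2 : ℕ) : ℂ) by norm_num, Complex.cpow_natCast]
    push_cast; ring
  set S : ℝ := ∑ n ∈ Finset.Icc 1 ⌊x⌋₊, C n * (Real.log (x / n)) ^ 6 / (6 : ℕ).factorial with hS
  have hSℂ : (∑ n ∈ Finset.Icc 1 ⌊x⌋₊, (C n : ℂ) * ((((Real.log (x / n) : ℝ) : ℂ) ^ 6) / ((6 : ℕ).factorial : ℂ))) =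
      ((S : ℝ) : ℂ) := by
    rw [hS]; push_cast
    refine Finset.sum_congr rfl fun n _ ↦ by ring
  rw [hSℂ, hP2] at hres
  -- `2π S - E = 2π φ(2) x²/2⁷`
  have hSeq : ((S : ℝ) : ℂ) = φ 2 * (((x ^ 2 / 2 ^ 7 : ℝ)) : ℂ) + E / (2 * Real.pi) := by
    have h2π : (2 * Real.pi : ℂ) ≠ 0 := by exact_mod_cast (by positivity : (2 * Real.pi : ℝ) ≠ 0)
    field_simp
    linear_combination hres
  have hSre : S = (φ 2).re * (x ^ 2 / 2 ^ 7) + E.re / (2 * Real.pi) := by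
    have := congrArg Complex.re hSeq
    rw [Complex.ofReal_re, Complex.add_re, Complex.re_mul_ofReal] at this
    rw [this]
    congr 1
    rw [show (2 * (Real.pi : ℂ)) = ((2 * Real.pi : ℝ) : ℂ) by push_cast; ring, Complex.div_ofReal_re]
  -- `‖E‖ ≤ x^a L₀`
  have hEn : ‖E‖ ≤ x ^ a * L₀ := by
    calc ‖E‖ ≤ ∫ y : ℝ, ‖F ((a : ℂ) + y * I)‖ := norm_integral_le_integral_norm _
      _ = ∫ y : ℝ, x ^ a * ‖Dt ((a : ℂ) + y * I) * perronPow 1 6 ((a : ℂ) + y * I)‖ := by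
          refine integral_congr_ae (ae_of_all _ fun y ↦ ?_)
          rw [hF]; simp only
          rw [perronPow_eq_cpow_mul x, norm_mul, norm_mul, norm_mul, hxnorm]; ring
      _ = x ^ a * L₀ := by rw [MeasureTheory.integral_const_mul]
  have hxa : 0 ≤ x ^ a := by positivity
  rw [hSre, show (φ 2).re * (x ^ 2 / 2 ^ 7) + E.re / (2 * Real.pi) - (φ 2).re / 2 ^ 7 * x ^ 2 =
    E.re / (2 * Real.pi) by ring, abs_div, abs_of_pos (by positivity : (0 : ℝ) < 2 * Real.pi),
    div_le_iff₀ (by positivity : (0 : ℝ) < 2 * Real.pi)]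
  calc |E.re| ≤ ‖E‖ := Complex.abs_re_le_norm E
    _ ≤ x ^ a * L₀ := hEn
    _ = L₀ / (2 * Real.pi) * x ^ (3 / 2 + ε) * (2 * Real.pi) := by rw [ha]; field_simp

end Shift

/-! ### The power saving for the coefficients -/

section PowerSaving

variable {C : ℕ → ℝ}

/-- **A power saving for the coefficients of a non-negative Dirichlet series with one simple
pole.** Under the hypotheses of `riesz_six_asymp` and `Re φ(2) ≥ 0`:
`Cₙ ≤ K' n^{2 - (1/2 - ε)/64}` for all `n ≥ 1` (six descent steps from the Riesz mean of order
`6`, then `coeff_le_of_partialSum`). [cite: MontgomeryVaughan2007, Section 5.2] -/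
theorem coeff_powerSaving_of_continuation (hC : ∀ n, 0 ≤ C n)
    (hCs : Summable fun n : ℕ ↦ C n / (n : ℝ) ^ (5 / 2 : ℝ))
    {Dt φ : ℂ → ℂ} (hDiff : DifferentiableOn ℂ Dt {w | 3 / 2 < w.re ∧ w ≠ 2})
    (hEq : ∀ w : ℂ, 2 < w.re → Dt w = LSeries (fun n ↦ (C n : ℂ)) w)
    (hφd : ∀ w : ℂ, 3 / 2 < w.re → DifferentiableAt ℂ φ w) (hφeq : ∀ w : ℂ, Dt w = φ w / (w - 2))
    (hφ2 : 0 ≤ (φ 2).re)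
    {ε K : ℝ} (hε : 0 < ε) (hε2 : ε < 1 / 2) (hK : 0 ≤ K)
    (hbd : ∀ w : ℂ, 3 / 2 + ε ≤ w.re → w.re ≤ 5 / 2 → 1 ≤ |w.im| → ‖Dt w‖ ≤ K * (1 + |w.im|) ^ 5) :
    ∃ K' : ℝ, ∀ n : ℕ, 1 ≤ n → C n ≤ K' * (n : ℝ) ^ (2 - (1 / 2 - ε) / 64) := by
  obtain ⟨L, hL0, hL⟩ := riesz_six_asymp hC hCs hDiff hEq hφd hφeq hε hε2 hK hbd
  -- the hypothesis of the descent in kernel form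
  have hyp : ∀ x : ℝ, 1 ≤ x →
      |(∑ n ∈ Icc 1 ⌊x⌋₊, C n *
          (if (6 : ℕ) = 0 then (if 0 ≤ Real.log (x / n) then 1 else 0)
            else (max (Real.log (x / n)) 0) ^ 6 / (6 : ℕ).factorial)) - (φ 2).re / 2 ^ 7 * x ^ 2| ≤
        L * x ^ (3 / 2 + ε) := by
    intro x hx
    rw [sum_kernel_eq_riesz (C := C) (by linarith) (by norm_num)]
    exact hL x hx
  obtain ⟨K₆, hK₆0, hK₆⟩ := riesz_descent_iter hC (m := 6) (by positivity) hL0 (by linarith) (by linarith) hyp 6 le_rfl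
  have hT : ∀ x : ℝ, 1 ≤ x → |(∑ n ∈ Icc 1 ⌊x⌋₊, C n) - 2 ^ 6 * ((φ 2).re / 2 ^ 7) * x ^ 2| ≤
      K₆ * x ^ (2 - (2 - (3 / 2 + ε)) / 2 ^ 6) := by
    intro x hx
    have h := hK₆ x hx
    rw [show 6 - 6 = 0 from rfl, sum_kernel_zero_eq_partialSum (C := C) (by linarith)] at h
    exact h
  refine ⟨2 * (2 ^ 6 * ((φ 2).re / 2 ^ 7)) + 2 * K₆, fun n hn ↦ ?_⟩
  have h := coeff_le_of_partialSum (C := C) (c := 2 ^ 6 * ((φ 2).re / 2 ^ 7)) (K := K₆)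
    (θ₀ := 2 - (2 - (3 / 2 + ε)) / 2 ^ 6) (by positivity) hK₆0 (by norm_num; linarith) hT hn
  rwa [show (2 : ℝ) - (2 - (3 / 2 + ε)) / 2 ^ 6 = 2 - (1 / 2 - ε) / 64 by ring] at h

end PowerSaving

end Literature.Analysis.Complex

end
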